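import Literature.NumberTheory.LFunctions.NoRealZeroDiscriminantCertificate
import Literature.Analysis.ValidatedNumerics.IntervalLogArctan
import HarnessLib

/-!
# Kernel replay of the Lu–Zaman–Zhao prime-sum certificates: the checker and its soundness

Topic `Literature/NumberTheory/LFunctions`. Lu–Zaman–Zhao (Math. Comp. 2026, arXiv:2602.03626),
§2.1–§3, exclude real zeros of `L(s, χ)` (`χ` quadratic of conductor `q`) in
`[1 − c/log q, 1]` by ONE decidable inequality per character: with a row `(λ, ϕ, E)` of their
Table 1 (`r = λ/(10 log 10)`, `σ = 1 + r`) the certificate (2.5) FAILS, i.e.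
`c/(r(r log q + c)) + (r + c/log q)/(r + 7/8)² + ϕ log q + E < ∑_{p ≤ N} (log p/(p^σ − 1) + (D/p) log p/(p^σ − (D/p)))`
(`D = χ(−1) q` the fundamental discriminant of `χ`). The tree holds the decision rule
(`LuZamanZhao2026.lfunction_ne_zero_of_rhs_lt_primeSum`, relative to the printed Theorem 2.1 =
`LuZamanZhao2026.theorem21`) and its discriminant form
(`noExceptionalZeroUpTo_of_discriminant_certificates`, `NoRealZeroDiscriminantCertificate.lean`).

This file mechanises the NUMERICAL side so that the KERNEL can replay such certificates
(`decide +kernel`, standard axioms only), for the fixed row `λ = 1.6` (`ϕ = 0.22675`,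
`E = 1.1614`) and `c = 1/5` — the rows of record of the `parity-realchar` cell (lineage B):

* arithmetic: the tree's fixed-point interval engine `NumericsMP.MI` at scale `SC = 2^64`
  (`MI.logNat2`, `MI.exp`, `MI.divPos`, … with their inclusion theorems `MI.mem_*`);
* the prime table: `PRow` = a prime `p` with three naturals `tPlus, tZero, tMinus` bounding from
  below `2^64 · 2 log p/(p^σ − 1)`, `2^64 · log p/(p^σ − 1)`, `2^64 · 2 log p/(p^{2σ} − 1)` — the
  summand of (2.3) for `(D/p) = 1, 0, −1`; a table is a LITERAL list (generated outside the kernel)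
  that the kernel VERIFIES entrywise against its own enclosures (`prow`, `entryCheck`, `tableCheck`,
  `sortedCheck`; soundness `entryValid_of_tableCheck`, `tableValid_of_checks`) — a wrong entry can
  only make a check fail, never prove a false statement (`EntryValid`, `TableValid`);
* the row search `rowSearch` / `rowOK`: for `D = ±Dabs` accumulate the selected table values along
  the primes and stop as soon as the partial sum exceeds the scaled upper bound `rhsHi` of the
  right-hand side — no per-discriminant data (`N`) is needed, the kernel finds it; the Kronecker
  symbols `(D/p)` are computed by Euler's criterion `a^{(p−1)/2} mod p` (two base-256 pieces of
  the exponent, four kernel `Nat.pow`/`Nat.mod` on numbers `< 2^9728`; `eulerCode`, `eulerCode_eq`) and by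
  `χ₈` at `p = 2` (`pick`, `pick_eq`, `kroneckerAtPrime_eq_of_eulerCode`);
  soundness `rowSearch_sound`, `rowOK_sound` (via `listSum_le_primeSumD`: the table primes used
  are distinct primes `≤ N`, all summands are `≥ 0`);
* coverage: `nonfundC` (a kernel witness — congruence or square prime factor — that `d` is not a
  fundamental discriminant; sound by `not_fund_of_nonfundC`), `memZ` (the exception list),
  `dOK`, `walk`, `checkRange T Q₀ Q₁ X` and its MEANING `CertifiedRange c Q₀ Q₁ X`: every
  fundamental discriminant `D` with `Q₀ < |D| ≤ Q₁` outside `X` has a Table-1 certificate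
  (`CertifiedAt c D`); `certifiedRange_of_checkRange`, `certifiedAt_of_checkOne`,
  `CertifiedRange.append / of_except / mono`, and the bridge
  `noExceptionalZeroUpTo_of_certifiedRange` to `NoExceptionalZeroUpTo Q c` (relative to the
  printed Theorem 2.1 `theorem21` and a base table, through
  `noExceptionalZeroUpTo_of_discriminant_certificates`).

Nothing is evaluated in this file; the literal tables and the per-range kernel computations live
in sibling files. Measured kernel cost (farm, 2026-08-25): ≈ 0.25 ms per (discriminant, prime)
term, ≈ 0.1 s per verified table entry; one `decide +kernel` call should stay below ≈ 1.2·10⁵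
terms.

## References

* W. Lu, A. Zaman, K. Zhao, *Dirichlet L-functions of quadratic characters have no exceptional
  zeros for moduli up to 10¹⁰*, Math. Comp. (2026), arXiv:2602.03626, §2.1–§3, Theorem 2.1,
  Table 1, (2.2)–(2.5). [LuZamanZhao2026]
* H. L. Montgomery, R. C. Vaughan, *Multiplicative Number Theory I*, CUP 2007, §9.3 (Kronecker
  symbol, Euler's criterion). [MontgomeryVaughan2007]
* R. E. Moore, *Interval Analysis*, Prentice-Hall 1966 (outward rounding). [folklore]
-/

open Finset Real

namespace Literature.NumberTheory.LFunctions
namespace LuZamanZhao2026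
namespace Replay

open Literature.Analysis.ValidatedNumerics Literature.Analysis.ValidatedNumerics.NumericsMP
open Literature.Barriers.RiemannHypothesis (IsFundamentalDiscriminant)

/-! ## The computational core -/

/-- Scale of the fixed-point intervals. [folklore] -/
def SC : ℕ := 2 ^ 64

/-- Series terms for logarithms (tail `≤ 2·2^{-41}`). [folklore] -/
def KL : ℕ := 40

/-- Series terms for the exponential. [folklore] -/
def KE : ℕ := 16

/-- Trial division: no `d' ≥ d` with `d'² ≤ n` divides `n` (fuel-bounded; `false` if the fuel
runs out). [folklore] -/
def noDivFrom (n : ℕ) : ℕ → ℕ → Bool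
  | 0, _ => false
  | fuel + 1, d => if n < d * d then true else if n % d = 0 then false else noDivFrom n fuel (d + 1)

/-- Primality by trial division from `2`. [folklore] -/
def isPrimeC (n : ℕ) : Bool := decide (2 ≤ n) && noDivFrom n n 2

/-- Per-prime data: `p` and natural numbers bounding from below, at scale `2^64`, the summand of
(2.3) for `(D/p) = 1, 0, −1`: `2 log p/(p^σ − 1)`, `log p/(p^σ − 1)`, `2 log p/(p^{2σ} − 1)`
(`σ = 1 + 1.6/(10 log 10)`). [cite: LuZamanZhao2026, (2.3)] -/
structure PRow where
  /-- the prime -/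
  p : ℕ
  /-- term bound for `(D/p) = 1` -/
  tPlus : ℕ
  /-- term bound for `(D/p) = 0` -/
  tZero : ℕ
  /-- term bound for `(D/p) = −1` -/
  tMinus : ℕ
  deriving DecidableEq, Repr

/-- Enclosure of `r = 1.6/(10 log 10) = (4/25)/log 10`. [cite: LuZamanZhao2026, Table 1] -/
def rI : Option MI :=
  match MI.logNat2 SC KL 10 with
  | some L => MI.divPos SC (MI.ofFrac SC 4 25) L
  | none => none

/-- The three term enclosures at `p` computed by the kernel (`R ∋ r`): intervals for
`2 log p/(p^σ − 1)`, `log p/(p^σ − 1)`, `2 log p/(p^{2σ} − 1)`. [cite: LuZamanZhao2026, (2.3)] -/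
def prow (R : MI) (p : ℕ) : Option (MI × MI × MI) :=
  match MI.logNat2 SC KL p with
  | none => none
  | some L =>
    match MI.exp SC KE 0 (MI.mul SC R L) with
    | none => none
    | some E =>
      let U := E.mulInt p
      let Um1 := U.sub (MI.ofInt SC 1)
      match MI.divPos SC (L.mulInt 2) Um1, MI.divPos SC L Um1,
        MI.divPos SC (L.mulInt 2) ((MI.sqr SC U).sub (MI.ofInt SC 1)) with
      | some A, some B, some C => some (A, B, C)
      | _, _, _ => none

/-- Kernel check of ONE literal table entry: `p` is prime and the three stored naturals are below
the kernel's own lower bounds. [folklore] -/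
def entryCheck (R : MI) (e : PRow) : Bool :=
  isPrimeC e.p &&
    match prow R e.p with
    | some (A, B, C) =>
      decide ((e.tPlus : ℤ) ≤ A.lo) && decide ((e.tZero : ℤ) ≤ B.lo) && decide ((e.tMinus : ℤ) ≤ C.lo)
    | none => false

/-- Kernel check of a literal table (chunk): every entry passes `entryCheck`. [folklore] -/
def tableCheck (R : MI) : List PRow → Bool
  | [] => true
  | e :: T => entryCheck R e && tableCheck R T

/-- The primes of a table increase strictly (one cheap pass). [folklore] -/
def sortedCheck : List PRow → Bool
  | [] => true
  | [_] => true
  | e :: e' :: T => decide (e.p < e'.p) && sortedCheck (e' :: T)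

/-- Euler's criterion code of `(a/p)` for an odd prime `p`: `a^{(p−1)/2} mod p ∈ {0, 1, p − 1}`,
computed in two base-256 pieces of the exponent `e = p/2 = 256·(e/256) + e mod 256`, reducing
`mod p` in between, so that for `p < 2^19` no intermediate number exceeds `2^9728` (the kernel's
GMP arithmetic then allocates nothing large, and few reduction steps are spent).
[cite: MontgomeryVaughan2007, §9.3] -/
def eulerCode (a p : ℕ) : ℕ :=
  ((a ^ (p / 2 / 256) % p) ^ 256 % p) * (a ^ (p / 2 % 256) % p) % p

/-- **`eulerCode a p = a^{p/2} mod p`.** [cite: MontgomeryVaughan2007, §9.3] -/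
theorem eulerCode_eq (a p : ℕ) : eulerCode a p = a ^ (p / 2) % p := by
  unfold eulerCode
  rw [← Nat.pow_mod, ← Nat.mul_mod, ← Nat.pow_mul, ← Nat.pow_add]
  congr 2
  omega

/-- The table value selected for the discriminant `D = ±Dabs` (`neg = true` for `D < 0`) at the
entry `e`: by `χ₈(D)` at `p = 2`, by Euler's criterion at odd `p`. [cite: MontgomeryVaughan2007, §9.3] -/
def pick (neg : Bool) (Dabs : ℕ) (e : PRow) : ℕ :=
  let t := Dabs % e.p
  if e.p = 2 then
    (if t = 0 then e.tZero else if Dabs % 8 = 1 ∨ Dabs % 8 = 7 then e.tPlus else e.tMinus)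
  else
    let a := if neg then (if t = 0 then 0 else e.p - t) else t
    let c := eulerCode a e.p
    if c = 1 then e.tPlus else if c = 0 then e.tZero else e.tMinus

/-- Scaled upper bound of the right-hand side of (2.5) at `c = 1/5`, row `λ = 1.6`
(`ϕ = 0.22675 = 907/4000`, `E = 1.1614 = 5807/5000`), for the modulus `q`:
`c/(r(r log q + c)) + (r + c/log q)/(r + 7/8)² + ϕ log q + E`. [cite: LuZamanZhao2026, (2.5) and Table 1] -/
def rhsHi (R : MI) (q : ℕ) : Option ℤ :=
  match MI.logNat2 SC KL q with
  | none => none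
  | some Lq =>
    let c := MI.ofFrac SC 1 5
    match MI.divPos SC c (MI.mul SC R ((MI.mul SC R Lq).add c)), MI.divPos SC c Lq with
    | some T1, some cL =>
      match MI.divPos SC (R.add cL) (MI.sqr SC (R.add (MI.ofFrac SC 7 8))) with
      | some T2 =>
        some ((T1.add T2).add (((MI.ofFrac SC 907 4000).mul SC Lq).add (MI.ofFrac SC 5807 5000))).hi
      | none => none
    | _, _ => none

/-- **The certificate search for one discriminant** `D = ±Dabs`: accumulate the scaled lower
bounds of the summands of (2.3) along the table and stop as soon as the partial sum exceeds the
scaled right-hand side `h` (the accumulator is forced to a numeral at every step, so that the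
kernel builds no deep chain of additions); `false` if the table is exhausted first.
[cite: LuZamanZhao2026, §2.1 (the algorithm) and (2.5)] -/
def rowSearch (neg : Bool) (Dabs : ℕ) (h : ℤ) : List PRow → ℕ → Bool
  | [], _ => false
  | e :: T, acc =>
    match acc + pick neg Dabs e with
    | 0 => rowSearch neg Dabs h T 0
    | k + 1 => if h < ((k + 1 : ℕ) : ℤ) then true else rowSearch neg Dabs h T (k + 1)

/-- The certificate test for `D = ±Dabs`: scaled `rhs < partial prime sum` for some prefix of
the table. [cite: LuZamanZhao2026, (2.5)] -/
def rowOK (R : MI) (T : List PRow) (neg : Bool) (Dabs : ℕ) : Bool :=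
  match rhsHi R Dabs with
  | some h => rowSearch neg Dabs h T 0
  | none => false

/-- `n` has the square of one of the table primes `p` with `p² ≤ n` as a factor. [folklore] -/
def hasSqFactor (n : ℕ) : List PRow → Bool
  | [] => false
  | e :: T => if n < e.p * e.p then false else if n % (e.p * e.p) = 0 then true else hasSqFactor n T

/-- A kernel witness that `d` is NOT a fundamental discriminant: wrong congruence class, or a
square prime factor (from the table) of `d` resp. `d/4`. [folklore] -/
def nonfundC (T : List PRow) (d : ℤ) : Bool :=
  if d % 4 = 1 then hasSqFactor d.natAbs T
  else if (4 : ℤ) ∣ d then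
    (if d / 4 % 4 = 2 ∨ d / 4 % 4 = 3 then hasSqFactor (d / 4).natAbs T else true)
  else true

/-- Membership in a list of integers (kernel-friendly). [folklore] -/
def memZ (d : ℤ) : List ℤ → Bool
  | [] => false
  | x :: xs => decide (x = d) || memZ d xs

/-- The signed discriminant `D = ±Dabs` encoded by `(neg, Dabs)`. [folklore] -/
def sgnD (neg : Bool) (Dabs : ℕ) : ℤ := if neg then -(Dabs : ℤ) else Dabs

/-- One discriminant `d = ±m` is dealt with: not fundamental, or deferred (`d ∈ X`), or certified.
[cite: LuZamanZhao2026, §2.1–§3] -/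
def dOK (R : MI) (T : List PRow) (X : List ℤ) (neg : Bool) (m : ℕ) : Bool :=
  nonfundC T (sgnD neg m) || memZ (sgnD neg m) X || rowOK R T neg m

/-- Walk the moduli `m, m + 1, …` (`fuel` of them), both signs each. [folklore] -/
def walk (R : MI) (T : List PRow) (X : List ℤ) : ℕ → ℕ → Bool
  | 0, _ => true
  | fuel + 1, m =>
    dOK R T X false m && dOK R T X true m &&
      (match m + 1 with
        | 0 => false
        | k + 1 => walk R T X fuel (k + 1))

/-- **The range checker**: with the literal table `T` (checked separately by `tableCheck` /
`sortedCheck`), every `d` with `Q₀ < |d| ≤ Q₁` is certified, or is not a fundamental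
discriminant, or is in the exception list `X`. No per-discriminant data is supplied: the kernel
finds the prime bound of each certificate itself. [cite: LuZamanZhao2026, §2.1–§3] -/
def checkRange (T : List PRow) (Q0 Q1 : ℕ) (X : List ℤ) : Bool :=
  match rI with
  | none => false
  | some R => walk R T X (Q1 - Q0) (Q0 + 1)

/-- **The single-discriminant checker** (for deferred rows, with a longer table): `D = ±Dabs`.
[cite: LuZamanZhao2026, §2.1–§3] -/
def checkOne (T : List PRow) (neg : Bool) (Dabs : ℕ) : Bool :=
  match rI with
  | none => false
  | some R => rowOK R T neg Dabs


/-! ### Meaning of the data -/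

/-- The exponent of the rows of record: `σ = 1 + r`, `r = 1.6/(10 log 10)`. [cite: LuZamanZhao2026, Table 1] -/
noncomputable def sig : ℝ := 1 + rOf 1.6

/-- The summand of the prime sum (2.3) at the prime `p` for the discriminant `D`.
[cite: LuZamanZhao2026, (2.3)] -/
noncomputable def term (D : ℤ) (p : ℕ) : ℝ :=
  Real.log p / ((p : ℝ) ^ sig - 1) +
    (kroneckerAtPrime D p : ℝ) * Real.log p / ((p : ℝ) ^ sig - (kroneckerAtPrime D p : ℝ))

/-- `primeSumD D σ N` is the sum of `term D p` over the primes `p ≤ N`. [cite: LuZamanZhao2026, (2.3)] -/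
theorem primeSumD_eq_sum_term (D : ℤ) (N : ℕ) :
    primeSumD D sig N = ∑ p ∈ (range (N + 1)).filter Nat.Prime, term D p := rfl

/-- Semantic validity of a table entry: `p` is prime and the three naturals are scaled lower
bounds of the three possible summands. [cite: LuZamanZhao2026, (2.3)] -/
def EntryValid (e : PRow) : Prop :=
  e.p.Prime ∧
    (e.tPlus : ℝ) ≤ 2 * Real.log e.p / ((e.p : ℝ) ^ sig - 1) * SC ∧
    (e.tZero : ℝ) ≤ Real.log e.p / ((e.p : ℝ) ^ sig - 1) * SC ∧
    (e.tMinus : ℝ) ≤ 2 * Real.log e.p / (((e.p : ℝ) ^ sig) ^ 2 - 1) * SC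

/-- A valid table: valid entries with strictly increasing primes. [cite: LuZamanZhao2026, §2.2 (the prime table) and (2.3)] -/
def TableValid (T : List PRow) : Prop :=
  (∀ e ∈ T, EntryValid e) ∧ (T.map PRow.p).Pairwise (· < ·)

/-! ### Trial division -/

/-- [folklore] -/
private theorem noDivFrom_sound {n : ℕ} : ∀ {fuel d : ℕ}, noDivFrom n fuel d = true →
    ∀ m, d ≤ m → m * m ≤ n → ¬ m ∣ n
  | 0, _, h => by simp [noDivFrom] at h
  | fuel + 1, d, h => by
    intro m hdm hmm hdvd
    unfold noDivFrom at h
    by_cases h1 : n < d * d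
    · have : d * d ≤ m * m := Nat.mul_le_mul hdm hdm
      omega
    rw [if_neg h1] at h
    by_cases h2 : n % d = 0
    · rw [if_pos h2] at h; exact Bool.false_ne_true h
    rw [if_neg h2] at h
    rcases Nat.eq_or_lt_of_le hdm with rfl | hlt
    · exact h2 (Nat.mod_eq_zero_of_dvd hdvd)
    · exact noDivFrom_sound h m hlt hmm hdvd

/-- `isPrimeC` is sound. [folklore] -/
private theorem prime_of_isPrimeC {n : ℕ} (h : isPrimeC n = true) : n.Prime := by
  unfold isPrimeC at h
  rw [Bool.and_eq_true, decide_eq_true_eq] at h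
  rw [Nat.prime_def_le_sqrt]
  refine ⟨h.1, fun m hm2 hms => noDivFrom_sound h.2 m hm2 ?_⟩
  exact Nat.le_sqrt.1 hms

/-! ### The enclosures -/

/-- `0 < SC`. [folklore] -/
private theorem SC_pos : 0 < SC := by unfold SC; positivity

/-- `rI ∋ r = rOf 1.6`. [cite: LuZamanZhao2026, Table 1] -/
theorem mem_rI {R : MI} (h : rI = some R) : MI.mem SC (rOf 1.6) R := by
  unfold rI at h
  split at h
  · rename_i L hL
    have hlog := MI.mem_logNat2 SC_pos hL
    have hfr := MI.mem_ofFrac SC (4 : ℤ) (q := 25) (by norm_num)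
    have := MI.mem_divPos SC_pos h hfr hlog
    convert this using 1
    unfold rOf
    push_cast
    ring
  · simp at h

/-- `0 < r`. [cite: LuZamanZhao2026, Table 1] -/
theorem rOf_pos : 0 < rOf 1.6 := by
  unfold rOf
  have : 0 < Real.log 10 := Real.log_pos (by norm_num)
  positivity

/-- `1 < σ`. [cite: LuZamanZhao2026, Table 1] -/
theorem one_lt_sig : 1 < sig := by
  unfold sig; linarith [rOf_pos]

/-- For `p ≥ 2`: `p^σ > 1`, indeed `p^σ ≥ 2`. [folklore] -/
private theorem two_le_rpow_sig {p : ℕ} (hp : 2 ≤ p) : (2 : ℝ) ≤ (p : ℝ) ^ sig := by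
  have hp' : (2 : ℝ) ≤ p := by exact_mod_cast hp
  calc (2 : ℝ) = 2 ^ (1 : ℝ) := by simp
    _ ≤ (p : ℝ) ^ (1 : ℝ) := Real.rpow_le_rpow (by norm_num) hp' (by norm_num)
    _ ≤ (p : ℝ) ^ sig := Real.rpow_le_rpow_of_exponent_le (by linarith) one_lt_sig.le

/-- The kernel's three term enclosures are correct. [cite: LuZamanZhao2026, (2.3)] -/
theorem prow_sound {R : MI} (hR : MI.mem SC (rOf 1.6) R) {p : ℕ} (hp : 2 ≤ p) {A B C : MI}
    (h : prow R p = some (A, B, C)) :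
    MI.mem SC (2 * Real.log p / ((p : ℝ) ^ sig - 1)) A ∧
      MI.mem SC (Real.log p / ((p : ℝ) ^ sig - 1)) B ∧
      MI.mem SC (2 * Real.log p / (((p : ℝ) ^ sig) ^ 2 - 1)) C := by
  unfold prow at h
  split at h
  · simp at h
  rename_i L hL
  split at h
  · simp at h
  rename_i E hE
  simp only at h
  split at h
  · rename_i A' B' C' hA hB hC
    simp only [Option.some.injEq, Prod.mk.injEq] at h
    obtain ⟨rfl, rfl, rfl⟩ := h
    have hlog := MI.mem_logNat2 SC_pos hL
    have hexp := MI.mem_exp SC_pos hE (MI.mem_mul SC_pos hR hlog)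
    -- `exp (r log p) * p = p ^ σ`
    have hp0 : (0 : ℝ) < p := by exact_mod_cast (show 0 < p by omega)
    have hU : MI.mem SC ((p : ℝ) ^ sig) (E.mulInt p) := by
      have := MI.mem_mulInt hexp (p : ℤ)
      convert this using 1
      rw [sig, add_comm, Real.rpow_add hp0, Real.rpow_one, Real.rpow_def_of_pos hp0]
      push_cast
      ring_nf
    have h1 := MI.mem_ofInt SC (1 : ℤ)
    have hUm1 : MI.mem SC ((p : ℝ) ^ sig - 1) ((E.mulInt p).sub (MI.ofInt SC 1)) := by
      simpa using MI.mem_sub hU h1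
    have hU2 : MI.mem SC (((p : ℝ) ^ sig) ^ 2 - 1) ((MI.sqr SC (E.mulInt p)).sub (MI.ofInt SC 1)) := by
      simpa using MI.mem_sub (MI.mem_sqr SC_pos hU) h1
    have hL2 : MI.mem SC (2 * Real.log p) (L.mulInt 2) := by
      simpa [mul_comm] using MI.mem_mulInt hlog (2 : ℤ)
    exact ⟨MI.mem_divPos SC_pos hA hL2 hUm1, MI.mem_divPos SC_pos hB hlog hUm1,
      MI.mem_divPos SC_pos hC hL2 hU2⟩
  · simp at h

/-- A checked entry is valid. [cite: LuZamanZhao2026, (2.3)] -/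
theorem entryValid_of_entryCheck {R : MI} (hR : MI.mem SC (rOf 1.6) R) {e : PRow}
    (h : entryCheck R e = true) : EntryValid e := by
  unfold entryCheck at h
  rw [Bool.and_eq_true] at h
  have hprime := prime_of_isPrimeC h.1
  refine ⟨hprime, ?_⟩
  have h2 := h.2
  split at h2
  · rename_i A B C hABC
    simp only [Bool.and_eq_true, decide_eq_true_eq] at h2
    obtain ⟨⟨ha, hb⟩, hc⟩ := h2
    obtain ⟨hA, hB, hC⟩ := prow_sound hR hprime.two_le hABC
    refine ⟨?_, ?_, ?_⟩
    · calc (e.tPlus : ℝ) = ((e.tPlus : ℤ) : ℝ) := by push_cast; rfl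
        _ ≤ (A.lo : ℝ) := by exact_mod_cast ha
        _ ≤ _ := hA.1
    · calc (e.tZero : ℝ) = ((e.tZero : ℤ) : ℝ) := by push_cast; rfl
        _ ≤ (B.lo : ℝ) := by exact_mod_cast hb
        _ ≤ _ := hB.1
    · calc (e.tMinus : ℝ) = ((e.tMinus : ℤ) : ℝ) := by push_cast; rfl
        _ ≤ (C.lo : ℝ) := by exact_mod_cast hc
        _ ≤ _ := hC.1
  · exact absurd h2 Bool.false_ne_true

/-- A checked table chunk has valid entries. [cite: LuZamanZhao2026, §2.2 and (2.3)] -/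
theorem entryValid_of_tableCheck {R : MI} (hR : MI.mem SC (rOf 1.6) R) :
    ∀ {T : List PRow}, tableCheck R T = true → ∀ e ∈ T, EntryValid e
  | [], _ => by simp
  | e :: T, h => by
    unfold tableCheck at h
    rw [Bool.and_eq_true] at h
    intro e' he'
    rcases List.mem_cons.1 he' with rfl | hm
    · exact entryValid_of_entryCheck hR h.1
    · exact entryValid_of_tableCheck hR h.2 e' hm

/-- `sortedCheck` is sound. [folklore] -/
private theorem pairwise_of_sortedCheck : ∀ {T : List PRow}, sortedCheck T = true → (T.map PRow.p).Pairwise (· < ·)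
  | [], _ => List.Pairwise.nil
  | [e], _ => by simp
  | e :: e' :: T, h => by
    unfold sortedCheck at h
    rw [Bool.and_eq_true, decide_eq_true_eq] at h
    have ih := pairwise_of_sortedCheck h.2
    rw [List.map_cons, List.pairwise_cons]
    refine ⟨fun q hq => ?_, ih⟩
    have ih' := ih
    rw [List.map_cons, List.pairwise_cons] at ih'
    rw [List.map_cons, List.mem_cons] at hq
    rcases hq with rfl | hq
    · exact h.1
    · exact h.1.trans (ih'.1 q hq)


/-! ### The Kronecker symbol by Euler's criterion -/

/-- `kroneckerAtPrime D p ∈ {0, 1, −1}`. [cite: MontgomeryVaughan2007, §9.3 Theorem 9.13] -/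
theorem kroneckerAtPrime_trichotomy (D : ℤ) (p : ℕ) :
    kroneckerAtPrime D p = 0 ∨ kroneckerAtPrime D p = 1 ∨ kroneckerAtPrime D p = -1 := by
  unfold kroneckerAtPrime
  split_ifs with h
  · rw [ZMod.χ₈_int_eq_if_mod_eight]
    split_ifs <;> simp
  · exact jacobiSym.trichotomy D p

/-- At `p = 2`: `(D/2) = χ₈(D)` read off `|D| mod 8` (for `D = ±Dabs`, `D mod 8 ∈ {1, 7}` iff
`Dabs mod 8 ∈ {1, 7}`). [cite: MontgomeryVaughan2007, §9.3 Theorem 9.13] -/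
theorem kroneckerAtPrime_two_eq (neg : Bool) (Dabs : ℕ) :
    kroneckerAtPrime (sgnD neg Dabs) 2 =
      if Dabs % 2 = 0 then 0 else if Dabs % 8 = 1 ∨ Dabs % 8 = 7 then 1 else -1 := by
  unfold kroneckerAtPrime
  rw [if_pos rfl, ZMod.χ₈_int_eq_if_mod_eight]
  unfold sgnD
  cases neg
  · simp only [Bool.false_eq_true, ↓reduceIte]
    have h2 : (Dabs : ℤ) % 2 = ((Dabs % 2 : ℕ) : ℤ) := by push_cast; rfl
    have h8 : (Dabs : ℤ) % 8 = ((Dabs % 8 : ℕ) : ℤ) := by push_cast; rfl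
    rw [h2, h8]
    by_cases h0 : Dabs % 2 = 0
    · simp [h0]
    · rw [if_neg (by omega), if_neg h0]
      by_cases h17 : Dabs % 8 = 1 ∨ Dabs % 8 = 7
      · rw [if_pos (by omega), if_pos h17]
      · rw [if_neg (by omega), if_neg h17]
  · simp only [↓reduceIte]
    by_cases h0 : Dabs % 2 = 0
    · rw [if_pos (by omega), if_pos h0]
    · rw [if_neg (by omega), if_neg h0]
      by_cases h17 : Dabs % 8 = 1 ∨ Dabs % 8 = 7
      · rw [if_pos (by omega), if_pos h17]
      · rw [if_neg (by omega), if_neg h17]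

/-- The residue fed to Euler's criterion represents `D` in `ZMod p` (`p` odd prime,
`t = Dabs mod p`, `a = t` for `D > 0`, `a = p − t` (or `0`) for `D < 0`). [folklore] -/
private theorem natCast_residue_eq (neg : Bool) (Dabs p : ℕ) [NeZero p] :
    (((if neg then (if Dabs % p = 0 then 0 else p - Dabs % p) else Dabs % p) : ℕ) : ZMod p) =
      ((sgnD neg Dabs : ℤ) : ZMod p) := by
  unfold sgnD
  have hm : ((Dabs % p : ℕ) : ZMod p) = (Dabs : ZMod p) := ZMod.natCast_mod Dabs p
  cases neg
  · simp only [Bool.false_eq_true, ↓reduceIte, Int.cast_natCast]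
    exact hm
  · simp only [↓reduceIte, Int.cast_neg, Int.cast_natCast]
    by_cases h0 : Dabs % p = 0
    · rw [if_pos h0, ← hm, h0]
      simp
    · rw [if_neg h0, Nat.cast_sub (Nat.mod_lt Dabs (NeZero.pos p)).le, ZMod.natCast_self, zero_sub, hm]

/-- **Euler's criterion, computed.** For an odd prime `p` and a natural `a` representing `D` mod
`p`, the code `c = a^{(p−1)/2} mod p` determines `(D/p)`: `c = 1 ↔ (D/p) = 1`, `c = 0 ↔ (D/p) = 0`,
otherwise `(D/p) = −1`. [cite: MontgomeryVaughan2007, §9.3] -/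
theorem kroneckerAtPrime_eq_of_eulerCode {p : ℕ} (hp : p.Prime) (hp2 : p ≠ 2) {D : ℤ} {a : ℕ}
    (ha : ((a : ℕ) : ZMod p) = (D : ZMod p)) :
    kroneckerAtPrime D p =
      if eulerCode a p = 1 then 1 else if eulerCode a p = 0 then 0 else -1 := by
  haveI := Fact.mk hp
  have hp1 : 1 < p := hp.one_lt
  unfold kroneckerAtPrime
  rw [if_neg hp2, ← jacobiSym.legendreSym.to_jacobiSym]
  -- the code as an element of `ZMod p` is the Legendre symbol
  have hc : ((eulerCode a p : ℕ) : ZMod p) = (legendreSym p D : ZMod p) := by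
    rw [eulerCode_eq, ZMod.natCast_mod, Nat.cast_pow, ha, legendreSym.eq_pow]
  have hclt : eulerCode a p < p := Nat.mod_lt _ hp.pos
  have htri : legendreSym p D = 0 ∨ legendreSym p D = 1 ∨ legendreSym p D = -1 := by
    by_cases h : (D : ZMod p) = 0
    · exact Or.inl ((legendreSym.eq_zero_iff p D).2 h)
    · exact Or.inr (legendreSym.eq_one_or_neg_one p h)
  rcases htri with h0 | h1 | hm1
  · -- `(D/p) = 0`: the code is `0`
    rw [h0, Int.cast_zero, ZMod.natCast_eq_zero_iff] at hc
    have : eulerCode a p = 0 := Nat.eq_zero_of_dvd_of_lt hc hclt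
    rw [h0, this]; simp
  · -- `(D/p) = 1`: the code is `1`
    rw [h1, Int.cast_one] at hc
    have : eulerCode a p = 1 := by
      have h' : ((eulerCode a p : ℕ) : ZMod p) = ((1 : ℕ) : ZMod p) := by rw [hc, Nat.cast_one]
      rw [ZMod.natCast_eq_natCast_iff'] at h'
      rwa [Nat.mod_eq_of_lt hclt, Nat.mod_eq_of_lt hp1] at h'
    rw [h1, this]; simp
  · -- `(D/p) = −1`: the code is neither `0` nor `1`
    rw [hm1, Int.cast_neg, Int.cast_one] at hc
    have hne0 : eulerCode a p ≠ 0 := by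
      intro h
      rw [h, Nat.cast_zero] at hc
      have : (1 : ZMod p) = 0 := by
        have := congrArg (fun x => -x) hc
        simpa using this.symm
      exact one_ne_zero this
    have hne1 : eulerCode a p ≠ 1 := by
      intro h
      rw [h, Nat.cast_one] at hc
      have h2 : ((2 : ℕ) : ZMod p) = 0 := by
        have h11 : (1 : ZMod p) + 1 = 0 := by
          nth_rewrite 1 [hc]
          ring
        rw [Nat.cast_ofNat]
        rw [← h11]
        ring
      rw [ZMod.natCast_eq_zero_iff] at h2
      exact hp2 ((Nat.prime_dvd_prime_iff_eq hp Nat.prime_two).1 h2)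
    rw [hm1, if_neg hne1, if_neg hne0]

/-- **`pick` selects the bound of the actual summand.** For a table entry at a prime `p` and
`D = ±Dabs`: `pick` returns `tPlus / tZero / tMinus` according as `(D/p) = 1 / 0 / −1`.
[cite: MontgomeryVaughan2007, §9.3] -/
theorem pick_eq (neg : Bool) (Dabs : ℕ) {e : PRow} (hp : e.p.Prime) :
    pick neg Dabs e =
      if kroneckerAtPrime (sgnD neg Dabs) e.p = 1 then e.tPlus
      else if kroneckerAtPrime (sgnD neg Dabs) e.p = 0 then e.tZero else e.tMinus := by
  unfold pick
  by_cases h2 : e.p = 2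
  · simp only [h2, ↓reduceIte, kroneckerAtPrime_two_eq]
    by_cases h0 : Dabs % 2 = 0
    · simp [h0]
    · rw [if_neg h0, if_neg h0]
      by_cases h17 : Dabs % 8 = 1 ∨ Dabs % 8 = 7
      · rw [if_pos h17, if_pos h17]; simp
      · rw [if_neg h17, if_neg h17]; simp
  · simp only [h2, ↓reduceIte]
    haveI : NeZero e.p := ⟨hp.ne_zero⟩
    rw [kroneckerAtPrime_eq_of_eulerCode hp h2 (natCast_residue_eq neg Dabs e.p)]
    by_cases hc1 : eulerCode (if neg then (if Dabs % e.p = 0 then 0 else e.p - Dabs % e.p) else Dabs % e.p) e.p = 1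
    · rw [if_pos hc1, if_pos hc1]; simp
    · rw [if_neg hc1, if_neg hc1]
      by_cases hc0 : eulerCode (if neg then (if Dabs % e.p = 0 then 0 else e.p - Dabs % e.p) else Dabs % e.p) e.p = 0
      · rw [if_pos hc0, if_pos hc0]; simp
      · rw [if_neg hc0, if_neg hc0]; simp


/-! ### The row sum is a lower bound of the prime sum -/

/-- Every summand of (2.3) is `≥ 0` (`p ≥ 2`, `σ > 1`, `(D/p) ∈ {0, ±1}`; for `(D/p) = −1` the
summand is `2 log p/(p^{2σ} − 1)`). [cite: LuZamanZhao2026, (2.3)] -/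
theorem term_nonneg (D : ℤ) {p : ℕ} (hp : 2 ≤ p) : 0 ≤ term D p := by
  have hu := two_le_rpow_sig hp
  have hlog : 0 ≤ Real.log p := Real.log_nonneg (by exact_mod_cast (show 1 ≤ p by omega))
  unfold term
  rcases kroneckerAtPrime_trichotomy D p with h | h | h <;> rw [h]
  · simp only [Int.cast_zero, zero_mul, zero_div, add_zero, sub_zero]
    exact div_nonneg hlog (by linarith)
  · push_cast
    have : 0 ≤ Real.log p / ((p : ℝ) ^ sig - 1) := div_nonneg hlog (by linarith)
    rw [one_mul]; linarith
  · push_cast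
    rw [show Real.log p / ((p : ℝ) ^ sig - 1) + -1 * Real.log p / ((p : ℝ) ^ sig - -1) =
      Real.log p * (1 / ((p : ℝ) ^ sig - 1) - 1 / ((p : ℝ) ^ sig + 1)) by ring]
    refine mul_nonneg hlog ?_
    rw [sub_nonneg]
    exact one_div_le_one_div_of_le (by linarith) (by linarith)

/-- For `(D/p) = −1` the summand is `2 log p/((p^σ)² − 1)`. [cite: LuZamanZhao2026, (2.3)] -/
theorem term_of_neg_one {D : ℤ} {p : ℕ} (hp : 2 ≤ p) (h : kroneckerAtPrime D p = -1) :
    term D p = 2 * Real.log p / (((p : ℝ) ^ sig) ^ 2 - 1) := by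
  have hu := two_le_rpow_sig hp
  unfold term
  rw [h]
  push_cast
  have h1 : (p : ℝ) ^ sig - 1 ≠ 0 := by linarith
  have h2 : (p : ℝ) ^ sig - -1 ≠ 0 := by linarith
  have h3 : ((p : ℝ) ^ sig) ^ 2 - 1 ≠ 0 := by nlinarith
  field_simp
  ring

/-- **`pick` is a scaled lower bound of the actual summand.** [cite: LuZamanZhao2026, (2.3)] -/
theorem pick_le_term (neg : Bool) (Dabs : ℕ) {e : PRow} (he : EntryValid e) :
    (pick neg Dabs e : ℝ) ≤ term (sgnD neg Dabs) e.p * SC := by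
  obtain ⟨hprime, hP, hZ, hM⟩ := he
  have hp2 := hprime.two_le
  rw [pick_eq neg Dabs hprime]
  rcases kroneckerAtPrime_trichotomy (sgnD neg Dabs) e.p with h | h | h
  · rw [if_neg (by rw [h]; norm_num), if_pos h]
    refine hZ.trans (le_of_eq ?_)
    unfold term; rw [h]; simp
  · rw [if_pos h]
    refine hP.trans (le_of_eq ?_)
    unfold term; rw [h]; push_cast; ring
  · rw [if_neg (by rw [h]; norm_num), if_neg (by rw [h]; norm_num), term_of_neg_one hp2 h]
    exact hM

/-- The list form of the partial prime sum: `∑_{e ∈ T, e.p ≤ N} term D e.p`. [cite: LuZamanZhao2026, (2.3)] -/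
noncomputable def listSum (D : ℤ) (N : ℕ) (T : List PRow) : ℝ :=
  ((T.filter fun e => e.p ≤ N).map fun e => term D e.p).sum

/-- [folklore] -/
private theorem listSum_nil (D : ℤ) (N : ℕ) : listSum D N [] = 0 := by simp [listSum]

/-- [folklore] -/
private theorem listSum_cons (D : ℤ) (N : ℕ) (e : PRow) (T : List PRow) :
    listSum D N (e :: T) = (if e.p ≤ N then term D e.p else 0) + listSum D N T := by
  unfold listSum
  rw [List.filter_cons]
  by_cases h : e.p ≤ N
  · simp [h]
  · simp [h]

/-- [folklore] -/
private theorem listSum_nonneg (D : ℤ) (N : ℕ) : ∀ {T : List PRow}, (∀ e ∈ T, EntryValid e) → 0 ≤ listSum D N T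
  | [], _ => by rw [listSum_nil]
  | e :: T, h => by
    rw [listSum_cons]
    have ih := listSum_nonneg D N (T := T) fun e' he' => h e' (List.mem_cons_of_mem _ he')
    have := term_nonneg D (h e List.mem_cons_self).1.two_le
    split_ifs <;> linarith

/-- In a sorted table the head prime is below every later prime. [folklore] -/
private theorem lt_of_sorted_cons {e : PRow} {T : List PRow} (h : ((e :: T).map PRow.p).Pairwise (· < ·)) :
    ∀ e' ∈ T, e.p < e'.p := by
  rw [List.map_cons, List.pairwise_cons] at h
  intro e' he'
  exact h.1 e'.p (List.mem_map.2 ⟨e', he', rfl⟩)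

/-- **Soundness of the certificate search.** If the search succeeds from the accumulator `acc` on
a sorted table with valid entries, then for some table prime `N = e'.p`:
`h < acc + 2^64 · ∑_{e ∈ T, e.p ≤ N} term D e.p`. [cite: LuZamanZhao2026, §2.1 and (2.5)] -/
theorem rowSearch_sound (neg : Bool) (Dabs : ℕ) (h : ℤ) :
    ∀ {T : List PRow} (acc : ℕ), (∀ e ∈ T, EntryValid e) → (T.map PRow.p).Pairwise (· < ·) →
      rowSearch neg Dabs h T acc = true →
      ∃ e' ∈ T, (h : ℝ) < acc + listSum (sgnD neg Dabs) e'.p T * SC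
  | [], acc, _, _, hs => by simp [rowSearch] at hs
  | e :: T, acc, hv, hsort, hs => by
    have he : EntryValid e := hv e List.mem_cons_self
    have hT : ∀ e' ∈ T, EntryValid e' := fun e' he' => hv e' (List.mem_cons_of_mem _ he')
    have hlt : ∀ e' ∈ T, e.p < e'.p := lt_of_sorted_cons hsort
    have hsort' : (T.map PRow.p).Pairwise (· < ·) := by
      rw [List.map_cons, List.pairwise_cons] at hsort; exact hsort.2
    have hpk := pick_le_term neg Dabs he
    have caseNow : (h : ℤ) < ((acc + pick neg Dabs e : ℕ) : ℤ) →
        ∃ e' ∈ e :: T, (h : ℝ) < acc + listSum (sgnD neg Dabs) e'.p (e :: T) * SC := by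
      intro hnow
      refine ⟨e, List.mem_cons_self, ?_⟩
      rw [listSum_cons, if_pos le_rfl]
      have h0 := listSum_nonneg (sgnD neg Dabs) e.p hT
      have hS : (0 : ℝ) ≤ SC := by exact_mod_cast SC_pos.le
      have : (h : ℝ) < (acc : ℝ) + (pick neg Dabs e : ℝ) := by exact_mod_cast hnow
      nlinarith
    have caseRec : rowSearch neg Dabs h T (acc + pick neg Dabs e) = true →
        ∃ e' ∈ e :: T, (h : ℝ) < acc + listSum (sgnD neg Dabs) e'.p (e :: T) * SC := by
      intro hr
      obtain ⟨e', he', hlt'⟩ := rowSearch_sound neg Dabs h (T := T) (acc + pick neg Dabs e) hT hsort' hr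
      refine ⟨e', List.mem_cons_of_mem _ he', ?_⟩
      rw [listSum_cons, if_pos (hlt e' he').le]
      push_cast at hlt'
      nlinarith [hpk]
    unfold rowSearch at hs
    split at hs
    · rename_i h0
      exact caseRec (by rw [h0]; exact hs)
    · rename_i k hk
      by_cases hnow : h < ((k + 1 : ℕ) : ℤ)
      · exact caseNow (by rw [hk]; exact hnow)
      · rw [if_neg hnow] at hs
        exact caseRec (by rw [hk]; exact hs)

/-- The primes of a valid table not exceeding `N` form a sublist-without-repetition of the primes
`≤ N`, so the partial list sum is at most `primeSumD`. [cite: LuZamanZhao2026, (2.3)] -/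
theorem listSum_le_primeSumD (D : ℤ) (N : ℕ) {T : List PRow} (hT : TableValid T) :
    listSum D N T ≤ primeSumD D sig N := by
  obtain ⟨hval, hsort⟩ := hT
  set L := (T.filter fun e => e.p ≤ N).map PRow.p with hL
  have hnodup : L.Nodup := by
    have h1 : (T.map PRow.p).Nodup := hsort.imp (fun {a b} h => Nat.ne_of_lt h)
    have : L.Sublist (T.map PRow.p) := by
      rw [hL]; exact List.filter_sublist.map _
    exact h1.sublist this
  have hsum : listSum D N T = ∑ p ∈ L.toFinset, term D p := by
    rw [List.sum_toFinset _ hnodup, listSum, hL, List.map_map]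
    rfl
  rw [hsum, primeSumD_eq_sum_term]
  apply Finset.sum_le_sum_of_subset_of_nonneg
  · intro p hp
    rw [List.mem_toFinset, hL, List.mem_map] at hp
    obtain ⟨e, he, rfl⟩ := hp
    rw [List.mem_filter, decide_eq_true_eq] at he
    rw [Finset.mem_filter, Finset.mem_range]
    exact ⟨by omega, (hval e he.1).1⟩
  · intro p hp _
    rw [Finset.mem_filter] at hp
    exact term_nonneg D hp.2.two_le

/-! ### The right-hand side -/

/-- **`rhsHi` bounds the right-hand side of (2.5) from above** (`c = 1/5`, row `λ = 1.6`).
[cite: LuZamanZhao2026, (2.5) and Table 1] -/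
theorem rhs_mul_le_rhsHi {R : MI} (hR : MI.mem SC (rOf 1.6) R) {q : ℕ} {h : ℤ}
    (hh : rhsHi R q = some h) : rhs (1 / 5) 1.6 0.22675 1.1614 q * SC ≤ h := by
  unfold rhsHi at hh
  split at hh
  · simp at hh
  rename_i Lq hLq
  simp only at hh
  split at hh
  · rename_i T1 cL hT1 hcL
    split at hh
    · rename_i T2 hT2
      simp only [Option.some.injEq] at hh
      subst hh
      have hlog := MI.mem_logNat2 SC_pos hLq
      have hc : MI.mem SC ((1 : ℝ) / 5) (MI.ofFrac SC 1 5) := by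
        simpa using MI.mem_ofFrac SC (1 : ℤ) (q := 5) (by norm_num)
      have h78 : MI.mem SC ((7 : ℝ) / 8) (MI.ofFrac SC 7 8) := by
        simpa using MI.mem_ofFrac SC (7 : ℤ) (q := 8) (by norm_num)
      have hphi : MI.mem SC ((907 : ℝ) / 4000) (MI.ofFrac SC 907 4000) := by
        simpa using MI.mem_ofFrac SC (907 : ℤ) (q := 4000) (by norm_num)
      have hE : MI.mem SC ((5807 : ℝ) / 5000) (MI.ofFrac SC 5807 5000) := by
        simpa using MI.mem_ofFrac SC (5807 : ℤ) (q := 5000) (by norm_num)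
      have m1 := MI.mem_divPos SC_pos hT1 hc
        (MI.mem_mul SC_pos hR (MI.mem_add (MI.mem_mul SC_pos hR hlog) hc))
      have m2 := MI.mem_divPos SC_pos hcL hc hlog
      have m3 := MI.mem_divPos SC_pos hT2 (MI.mem_add hR m2) (MI.mem_sqr SC_pos (MI.mem_add hR h78))
      have m4 := MI.mem_add (MI.mem_add m1 m3) (MI.mem_add (MI.mem_mul SC_pos hphi hlog) hE)
      have := m4.2
      convert this using 2
      unfold rhs
      norm_num
      ring
    · simp at hh
  · simp at hh

/-- **Soundness of the row test**: a passing `rowOK` is a Table-1 certificate (`λ = 1.6`) for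
`D = ±Dabs`: `rhs (1/5) < primeSumD D σ N` for some `N`. [cite: LuZamanZhao2026, (2.5)] -/
theorem rowOK_sound {R : MI} (hR : MI.mem SC (rOf 1.6) R) {T : List PRow} (hT : TableValid T)
    {neg : Bool} {Dabs : ℕ} (h : rowOK R T neg Dabs = true) :
    ∃ N : ℕ, rhs (1 / 5) 1.6 0.22675 1.1614 Dabs < primeSumD (sgnD neg Dabs) (1 + rOf 1.6) N := by
  unfold rowOK at h
  split at h
  · rename_i hh hrhs
    obtain ⟨e', -, hlt⟩ := rowSearch_sound neg Dabs hh 0 hT.1 hT.2 h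
    refine ⟨e'.p, ?_⟩
    have h1 := rhs_mul_le_rhsHi hR hrhs
    have h3 := listSum_le_primeSumD (sgnD neg Dabs) e'.p hT
    have hS : (0 : ℝ) < SC := by exact_mod_cast SC_pos
    push_cast at hlt
    rw [zero_add] at hlt
    have : rhs (1 / 5) 1.6 0.22675 1.1614 Dabs * SC < primeSumD (sgnD neg Dabs) sig e'.p * SC := by
      nlinarith
    exact lt_of_mul_lt_mul_right this hS.le
  · exact absurd h Bool.false_ne_true


/-! ### Meaning of a certified range -/

/-- **A Table-1 certificate for the discriminant `D` at width `c`**: some printed row `(λ, ϕ, E)`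
and some `N` with `rhs c λ ϕ E |D| < primeSumD D (1 + r) N` — the hypothesis shape of
`noExceptionalZeroUpTo_of_discriminant_certificates`. [cite: LuZamanZhao2026, §2.1–§3] -/
def CertifiedAt (c : ℝ) (D : ℤ) : Prop :=
  ∃ lam phi E : ℝ, Table1 lam phi E ∧ ∃ N : ℕ, rhs c lam phi E D.natAbs < primeSumD D (1 + rOf lam) N

/-- **A certified range with exceptions**: every fundamental discriminant `D` with
`Q₀ < |D| ≤ Q₁` outside the list `X` has a Table-1 certificate at width `c`.
[cite: LuZamanZhao2026, §2.1–§3] -/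
def CertifiedRange (c : ℝ) (Q0 Q1 : ℕ) (X : List ℤ) : Prop :=
  ∀ D : ℤ, IsFundamentalDiscriminant D → (Q0 : ℤ) < |D| → |D| ≤ (Q1 : ℤ) → D ∉ X → CertifiedAt c D

/-- `|sgnD neg Dabs| = Dabs`. [folklore] -/
private theorem natAbs_sgnD (neg : Bool) (Dabs : ℕ) : (sgnD neg Dabs).natAbs = Dabs := by
  unfold sgnD; cases neg <;> simp

/-- A passing row test is a certificate (row `λ = 1.6` of Table 1). [cite: LuZamanZhao2026, (2.5) and Table 1] -/
theorem certifiedAt_of_rowOK {R : MI} (hR : MI.mem SC (rOf 1.6) R) {T : List PRow} (hT : TableValid T)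
    {neg : Bool} {Dabs : ℕ} (h : rowOK R T neg Dabs = true) : CertifiedAt (1 / 5) (sgnD neg Dabs) := by
  obtain ⟨N, hN⟩ := rowOK_sound hR hT h
  refine ⟨1.6, 0.22675, 1.1614, Or.inl ⟨rfl, rfl, rfl⟩, N, ?_⟩
  rw [natAbs_sgnD]
  exact hN

/-! ### The non-fundamental witnesses -/

/-- A square factor `w² > 1` kills square-freeness. [folklore] -/
private theorem not_squarefree_of_sq_dvd {w : ℕ} (hw : 1 < w) {n : ℤ} (h : ((w * w : ℕ) : ℤ) ∣ n) :
    ¬ Squarefree n := by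
  intro hsq
  have := hsq (w : ℤ) (by exact_mod_cast h)
  rw [Int.isUnit_iff] at this
  omega

/-- `hasSqFactor` finds a genuine square factor. [folklore] -/
private theorem exists_sq_dvd_of_hasSqFactor {n : ℕ} : ∀ {T : List PRow}, (∀ e ∈ T, EntryValid e) →
    hasSqFactor n T = true → ∃ w : ℕ, 1 < w ∧ w * w ∣ n
  | [], _, h => by simp [hasSqFactor] at h
  | e :: T, hv, h => by
    unfold hasSqFactor at h
    by_cases h1 : n < e.p * e.p
    · rw [if_pos h1] at h; exact absurd h Bool.false_ne_true
    rw [if_neg h1] at h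
    by_cases h2 : n % (e.p * e.p) = 0
    · exact ⟨e.p, (hv e List.mem_cons_self).1.one_lt, Nat.dvd_of_mod_eq_zero h2⟩
    · rw [if_neg h2] at h
      exact exists_sq_dvd_of_hasSqFactor (fun e' he' => hv e' (List.mem_cons_of_mem _ he')) h

/-- **`nonfundC` is sound**: it only fires on integers that are not fundamental discriminants.
[cite: MontgomeryVaughan2007, §9.3 (fundamental discriminants)] -/
theorem not_fund_of_nonfundC {T : List PRow} (hv : ∀ e ∈ T, EntryValid e) {d : ℤ}
    (h : nonfundC T d = true) : ¬ IsFundamentalDiscriminant d := by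
  unfold nonfundC at h
  rintro (⟨h1, hsf, -⟩ | ⟨h4, h23, hsf⟩)
  · rw [if_pos h1] at h
    obtain ⟨w, hw, hdvd⟩ := exists_sq_dvd_of_hasSqFactor hv h
    refine not_squarefree_of_sq_dvd hw ?_ hsf
    exact Int.natCast_dvd.2 (by simpa using hdvd)
  · have h1 : ¬ d % 4 = 1 := by omega
    rw [if_neg h1, if_pos h4, if_pos h23] at h
    obtain ⟨w, hw, hdvd⟩ := exists_sq_dvd_of_hasSqFactor hv h
    refine not_squarefree_of_sq_dvd hw ?_ hsf
    exact Int.natCast_dvd.2 (by simpa using hdvd)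

/-- [folklore] -/
private theorem mem_of_memZ {d : ℤ} : ∀ {X : List ℤ}, memZ d X = true → d ∈ X
  | [], h => by simp [memZ] at h
  | x :: xs, h => by
    unfold memZ at h
    rw [Bool.or_eq_true, decide_eq_true_eq] at h
    rcases h with rfl | h
    · exact List.mem_cons_self
    · exact List.mem_cons_of_mem _ (mem_of_memZ h)

/-! ### Soundness of the walk -/

/-- What `dOK` gives for `D = ±m`. [cite: LuZamanZhao2026, §2.1–§3] -/
theorem dOK_sound {R : MI} (hR : MI.mem SC (rOf 1.6) R) {T : List PRow} (hT : TableValid T)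
    {X : List ℤ} {neg : Bool} {m : ℕ} (h : dOK R T X neg m = true) :
    IsFundamentalDiscriminant (sgnD neg m) → sgnD neg m ∉ X → CertifiedAt (1 / 5) (sgnD neg m) := by
  intro hfd hX
  unfold dOK at h
  rw [Bool.or_eq_true, Bool.or_eq_true] at h
  rcases h with (h | h) | h
  · exact absurd hfd (not_fund_of_nonfundC hT.1 h)
  · exact absurd (mem_of_memZ h) hX
  · exact certifiedAt_of_rowOK hR hT h

/-- The walk certifies the moduli `m ≤ n < m + fuel`, both signs. [cite: LuZamanZhao2026, §2.1–§3] -/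
theorem walk_sound {R : MI} (hR : MI.mem SC (rOf 1.6) R) {T : List PRow} (hT : TableValid T)
    {X : List ℤ} : ∀ {fuel m : ℕ}, walk R T X fuel m = true →
      ∀ n : ℕ, m ≤ n → n < m + fuel → ∀ neg : Bool,
        IsFundamentalDiscriminant (sgnD neg n) → sgnD neg n ∉ X → CertifiedAt (1 / 5) (sgnD neg n)
  | 0, m, _ => by intro n h1 h2; omega
  | fuel + 1, m, h => by
    unfold walk at h
    simp only [Bool.and_eq_true] at h
    obtain ⟨⟨h1, h2⟩, h3⟩ := h
    intro n hmn hnf neg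
    rcases Nat.eq_or_lt_of_le hmn with rfl | hlt
    · cases neg
      · exact dOK_sound hR hT h1
      · exact dOK_sound hR hT h2
    · exact walk_sound hR hT h3 n hlt (by omega) neg

/-- **Soundness of the range checker.** If the literal table is valid (`tableCheck`, `sortedCheck`)
and `checkRange T Q₀ Q₁ X = true`, then `CertifiedRange (1/5) Q₀ Q₁ X`.
[cite: LuZamanZhao2026, §2.1–§3] -/
theorem certifiedRange_of_checkRange {T : List PRow} (hT : TableValid T) {Q0 Q1 : ℕ} {X : List ℤ}
    (h : checkRange T Q0 Q1 X = true) : CertifiedRange (1 / 5) Q0 Q1 X := by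
  unfold checkRange at h
  split at h
  · exact absurd h Bool.false_ne_true
  rename_i R hR
  intro D hfd hlo hhi hX
  have hn : ((D.natAbs : ℕ) : ℤ) = |D| := Int.natCast_natAbs D
  have h1 : Q0 < D.natAbs := by
    have := hlo; rw [← hn] at this; exact_mod_cast this
  have h2 : D.natAbs ≤ Q1 := by
    have := hhi; rw [← hn] at this; exact_mod_cast this
  have hw := walk_sound (mem_rI hR) hT h D.natAbs (by omega) (by omega)
  rcases Int.natAbs_eq D with hD | hD
  · have e : sgnD false D.natAbs = D := by rw [sgnD]; simpa using hD.symm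
    have := hw false
    rw [e] at this
    exact this hfd hX
  · have e : sgnD true D.natAbs = D := by rw [sgnD]; simpa using hD.symm
    have := hw true
    rw [e] at this
    exact this hfd hX

/-- **Soundness of the single-discriminant checker.** [cite: LuZamanZhao2026, §2.1–§3] -/
theorem certifiedAt_of_checkOne {T : List PRow} (hT : TableValid T) {neg : Bool} {Dabs : ℕ}
    (h : checkOne T neg Dabs = true) : CertifiedAt (1 / 5) (sgnD neg Dabs) := by
  unfold checkOne at h
  split at h
  · exact absurd h Bool.false_ne_true
  rename_i R hR
  exact certifiedAt_of_rowOK (mem_rI hR) hT h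

/-- Entrywise validity of a table chunk from its kernel check (the `match` on `rI` included, as
the chunk theorems of the table files state it). [cite: LuZamanZhao2026, §2.2 and (2.3)] -/
theorem entryValid_of_chunk {T : List PRow}
    (h : (match rI with | some R => tableCheck R T | none => false) = true) : ∀ e ∈ T, EntryValid e := by
  split at h
  · rename_i R hR
    exact entryValid_of_tableCheck (mem_rI hR) h
  · exact absurd h Bool.false_ne_true

/-- A valid table from entrywise validity and the sortedness check. [cite: LuZamanZhao2026, §2.2 and (2.3)] -/
theorem tableValid_of {T : List PRow} (hv : ∀ e ∈ T, EntryValid e) (hs : sortedCheck T = true) :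
    TableValid T :=
  ⟨hv, pairwise_of_sortedCheck hs⟩

/-- A valid table from the two kernel checks. [cite: LuZamanZhao2026, §2.2 and (2.3)] -/
theorem tableValid_of_checks {T : List PRow} {R : MI} (hR : rI = some R) (h1 : tableCheck R T = true)
    (h2 : sortedCheck T = true) : TableValid T :=
  ⟨entryValid_of_tableCheck (mem_rI hR) h1, pairwise_of_sortedCheck h2⟩

/-- Valid tables concatenate (the last prime of the first below the first prime of the second is
what `sortedCheck` of the junction gives; here stated with the pairwise condition). [cite: LuZamanZhao2026, §2.2 and (2.3)] -/
theorem TableValid.append {T₁ T₂ : List PRow} (h₁ : TableValid T₁) (h₂ : TableValid T₂)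
    (h : ∀ e₁ ∈ T₁, ∀ e₂ ∈ T₂, e₁.p < e₂.p) : TableValid (T₁ ++ T₂) := by
  refine ⟨fun e he => ?_, ?_⟩
  · rcases List.mem_append.1 he with he | he
    · exact h₁.1 e he
    · exact h₂.1 e he
  · rw [List.map_append, List.pairwise_append]
    refine ⟨h₁.2, h₂.2, fun a ha b hb => ?_⟩
    rw [List.mem_map] at ha hb
    obtain ⟨e₁, he₁, rfl⟩ := ha
    obtain ⟨e₂, he₂, rfl⟩ := hb
    exact h e₁ he₁ e₂ he₂

/-- Entrywise validity of a concatenation from its chunks (for chunked `tableCheck` runs). [cite: LuZamanZhao2026, §2.2 and (2.3)] -/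
theorem entryValid_append {T₁ T₂ : List PRow} (h₁ : ∀ e ∈ T₁, EntryValid e) (h₂ : ∀ e ∈ T₂, EntryValid e) :
    ∀ e ∈ T₁ ++ T₂, EntryValid e := fun e he => by
  rcases List.mem_append.1 he with he | he
  · exact h₁ e he
  · exact h₂ e he

/-! ### Combining ranges and the bridge to `NoExceptionalZeroUpTo` -/

/-- Adjacent certified ranges concatenate (exception lists too). [cite: LuZamanZhao2026, §2.1–§3] -/
theorem CertifiedRange.append {c : ℝ} {Q0 Q1 Q2 : ℕ} {X Y : List ℤ} (h1 : CertifiedRange c Q0 Q1 X)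
    (h2 : CertifiedRange c Q1 Q2 Y) : CertifiedRange c Q0 Q2 (X ++ Y) := by
  intro D hfd hlo hhi hXY
  rw [List.mem_append, not_or] at hXY
  by_cases hD : |D| ≤ (Q1 : ℤ)
  · exact h1 D hfd hlo hD hXY.1
  · exact h2 D hfd (lt_of_not_ge hD) hhi hXY.2

/-- Adjacent certified ranges with the SAME exception list concatenate (the form used by the
range files, whose sub-window checks share one exception list). [cite: LuZamanZhao2026, §2.1–§3] -/
theorem CertifiedRange.append_same {c : ℝ} {Q0 Q1 Q2 : ℕ} {X : List ℤ} (h1 : CertifiedRange c Q0 Q1 X)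
    (h2 : CertifiedRange c Q1 Q2 X) : CertifiedRange c Q0 Q2 X := by
  intro D hfd hlo hhi hX
  by_cases hD : |D| ≤ (Q1 : ℤ)
  · exact h1 D hfd hlo hD hX
  · exact h2 D hfd (lt_of_not_ge hD) hhi hX

/-- Replacing the exception list: exceptions certified separately may be dropped. [cite: LuZamanZhao2026, §2.1–§3] -/
theorem CertifiedRange.of_except {c : ℝ} {Q0 Q1 : ℕ} {X Y : List ℤ} (h : CertifiedRange c Q0 Q1 X)
    (hX : ∀ D ∈ X, D ∉ Y → CertifiedAt c D) : CertifiedRange c Q0 Q1 Y := by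
  intro D hfd hlo hhi hY
  by_cases hD : D ∈ X
  · exact hX D hD hY
  · exact h D hfd hlo hhi hD

/-- Shrinking the range. [cite: LuZamanZhao2026, §2.1–§3] -/
theorem CertifiedRange.mono {c : ℝ} {Q0 Q1 Q0' Q1' : ℕ} {X : List ℤ} (h : CertifiedRange c Q0 Q1 X)
    (h0 : Q0 ≤ Q0') (h1 : Q1' ≤ Q1) : CertifiedRange c Q0' Q1' X :=
  fun D hfd hlo hhi hX => h D hfd (by omega) (by omega) hX

/-- **The bridge.** Assume Lu–Zaman–Zhao's Theorem 2.1 (`theorem21`, as printed), a base table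
`NoExceptionalZeroUpTo Q₀ c` and a certified range `(Q₀, Q]` with NO exceptions. Then
`NoExceptionalZeroUpTo Q c`: no primitive quadratic `L(s, χ)` of modulus `3 ≤ q ≤ Q` vanishes on
`[1 − c/log q, 1] ∩ (0, 1]`. [cite: LuZamanZhao2026, §2.1–§3] -/
theorem noExceptionalZeroUpTo_of_certifiedRange (h21 : theorem21) {c : ℝ} (hc : 0 < c) {Q0 Q : ℕ}
    (h₀ : NoExceptionalZeroUpTo Q0 c) (h : CertifiedRange c Q0 Q []) : NoExceptionalZeroUpTo Q c :=
  noExceptionalZeroUpTo_of_discriminant_certificates h21 hc h₀ fun D hfd hlo hhi =>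
    h D hfd hlo hhi (by simp)

end Replay
end LuZamanZhao2026
end Literature.NumberTheory.LFunctions
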